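import Summits.BirchSwinnertonDyer.BirchSwinnertonDyer.Theorems.AlignedTransportAtTwoMainConjectureOfRankZeroBSDAtTwoCubicOffStratumFukudaIndexTransfer
import Summits.BirchSwinnertonDyer.BirchSwinnertonDyer.Theorems.AlignedTransportAtTwoMainConjectureOfRankZeroBSDAtTwoCubicOffStratumDedekindTable
import Summits.BirchSwinnertonDyer.BirchSwinnertonDyer.Theorems.AlignedTransportAtTwoMainConjectureOfRankZeroBSDAtTwoSexticTowerGrowth
import Literature.NumberTheory.IwasawaTheory.Fukuda1994Thm1RankProofs
import Literature.NumberTheory.IwasawaTheory.Fukuda1994Thm1Consequences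
import Mathlib.NumberTheory.RamificationInertia.Galois
import HarnessLib

/-!
# Route `AlignedTransportAtTwo`, crux C2 `MainConjectureOfRankZeroBSDAtTwo` (stmt-BirchSwinnertonDyer-22298):
# FUKUDA'S INDEX IS `0` FOR THE CUBIC `2`-TORSION FIELD `ℚ(β)` OF EVERY GOOD-ORDINARY SEED-CELL CURVE WITH `E(ℚ)[2] = 0` — the sub-cell `Δ_min ≡ 3 (mod 4)`
# (where the prime `𝔭₂` of `ℚ(β)` has `e = 2`) decided in the kernel: `𝔭₂` ramifies AGAIN in `ℚ(β)(√2)`; the class-group doors lose their ramification bit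

HONEST FRAMING (cell `bsd-f1-sign2`, WIDTH-5 attached prover seat `bsd-line-att-p5` gen 28 on line `birth` of the lead `bsd-line-att-p2`;
`--supports` stmt-BirchSwinnertonDyer-22298, closes nothing; BSD is NOT proved by any of this; the crux C2, its verdict «blocked-on
`Rank1Residual.GreenbergMuConjectureIrreducible`» and every registered stub are untouched). THEOREMS ONLY — no definition, no named fact,
no `sorry`. Sequel of att-p5 g27 (`…CubicOffStratumRamification`: «every prime of `ℚ(β)` above `2` has odd index ⟺ `Δ_min ≡ 1 (mod 4)`»;
`…CubicOffStratumDedekindTable`: on `Δ_min ≡ 3 (mod 4)` the second prime has `(e, f) = (2, 1)`) and of att-p4 g24's reading «the stratum-agnostic Fukuda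
doors display exactly ONE local bit `TotallyRamifiedFrom κP 0` for `ℚ(β)`; on `Δ_min ≡ 3 (4) — where 2045b1 sits — discharging it = 𝔭₂ ramifies in
`ℚ(β)(√2)/ℚ(β)`». That bit is now a KERNEL THEOREM for every good-ordinary `W` with `E(ℚ)[2] = 0` (all residues of `Δ_min mod 8`).

* §1 **`ramificationIdx_divisionField_two_eq_two_of_minimalDiscriminantInt_emod_four_eq_three`**: `W` good ordinary at `2`, no rational `2`-torsion
  abscissa, `Δ_min ≡ 3 (mod 4)` ⟹ EVERY prime of `T = ℚ(W[2])` above `2` has `e = 2` (even: `4δ₀ ∈ T`, `(4δ₀)² = Δ_min`; `≤ 2`: `T/ℚ` Galois and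
  above the prime of `ℚ(β)` cut out by the `2`-adic root of `c_W` (`e = 1`) the index is `≤ [T : ℚ(β)] = 6/3 = 2`).
* §2 **`totallyRamifiedFrom_zero_adjoin_of_minimalDiscriminantInt_emod_four_eq_three`**: under the same hypotheses EVERY cyclotomic `ℤ₂`-extension `κ`
  of `ℚ(β)` has `TotallyRamifiedFrom κ 0`. Inside `\overline{ℚ(β)}`: `L = κ.layer 1 ∋ √2` (bsd-2adic), `T` = a copy of `ℚ(W[2])` over `ℚ(β)` (its primes
  above `2` have `e = 2` by §1, transported along `𝓞`-isomorphism), `𝔭₂` from g27's table; the ramification transfer (`…FukudaIndexTransfer` §3: `4 ∣ e`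
  from `√2, √Δ_min`, `#I = e`, product inequality over `L·T`) yields a prime `Q ∋ 2` of `L` with `4 ∣ e(Q|2)`, and the cubic criterion (§4 there) concludes.
  Classically: the completion `ℚ(β)_{𝔭₂} = ℚ₂(√Δ_min)` is `ℚ₂(√3)` or `ℚ₂(√7)`, never `ℚ₂(√2)`, `ℚ₂(√10)`.
* §3 **`totallyRamifiedFrom_zero_adjoin_of_isOrdinaryAt_two`** — UNIFORM: `W` globally minimal, good ordinary at `2`, `E(ℚ)[2] = 0` ⟹ Fukuda's index is
  `0` for every cyclotomic `ℤ₂`-extension of `ℚ(β)` (`Δ_min ≡ 1 (4)`: all indices odd, g26/g27 + bsd-2adic parity; `≡ 3 (4)`: §2); hence the layer-pair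
  doors with NO index restriction and NO ramification bit: `classicalMuVanishes_adjoin_of_classNumberPExp_succ_eq` / `…_of_classGroupPRank_succ_eq`
  (ONE pair of consecutive layers `(n, n+1)`, ANY `n ≥ 0`, with equal `2`-class-number exponent / equal `2`-rank ⟹ `μ₂(ℚ(β)^{cyc}) = 0`).

Nothing is asserted about any curve's class groups; nothing is closed; BSD is not proved. PARTITION: the OFF-stratum seed `2045b1` (`Δ_min ≡ 3 (8)`,
att-p4 g24) may now be certified at the layer pair `(0, 1)` as well.

References: [NeukirchANT1999] Ch. I §8 Prop. (8.2), §9 Prop. (9.4)/(9.6), Ch. II §8; [Washington1997] §13.1 Prop. 13.2, Lemma 13.3; [Fukuda1994] Thm. 1, p. 264;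
[SilvermanAEC2009] VII.2, VIII.§1; [Marcus2018] Ch. 3 Thm. 25, Ch. 4; tree: bsd-2adic `CyclotomicTwoTotallyRamified{OddIndex,EvenIndexCertificate}`,
att-p5 g26/g27, att-p3 g26 `…SexticTowerGrowth`, att-p4 g24 `…CubicRankDoorLayerOne`.
-/

set_option linter.dupNamespace false
set_option autoImplicit false

noncomputable section

open scoped Classical NumberField nonZeroDivisors

namespace Summit.BirchSwinnertonDyer.BirchSwinnertonDyer.Theorems.AlignedTransportAtTwoCubicOffStratumFukudaIndex

open NumberField IsDedekindDomain Polynomial WeierstrassCurve IntermediateField Field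
  Literature.NumberTheory.IwasawaTheory Literature.NumberTheory.GaloisRepresentations
  Literature.NumberTheory.EllipticCurves Literature.NumberTheory.EllipticCurves.Greenberg1999
  Literature.NumberTheory.EllipticCurves.DokchitserDokchitser2012
  Summit.BirchSwinnertonDyer.Rank1Residual.F1Sign2
  Summit.BirchSwinnertonDyer.BirchSwinnertonDyer.Theorems.AlignedTransportAtTwoBridge
  Summit.BirchSwinnertonDyer.BirchSwinnertonDyer.Theorems.AlignedTransportAtTwoKilfordStratumShared
  Summit.BirchSwinnertonDyer.BirchSwinnertonDyer.Theorems.AlignedTransportAtTwoKilfordStratum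
  Summit.BirchSwinnertonDyer.BirchSwinnertonDyer.Theorems.AlignedTransportAtTwoFineRoad.DivisionCubic
  Summit.BirchSwinnertonDyer.BirchSwinnertonDyer.Theorems.AlignedTransportAtTwoFineRoad.TowerImageDelta
  Summit.BirchSwinnertonDyer.BirchSwinnertonDyer.Theorems.AlignedTransportAtTwoCubicKilfordPrimes
  Summit.BirchSwinnertonDyer.BirchSwinnertonDyer.Theorems.AlignedTransportAtTwoCubicPrimesOfEmbeddings
  Summit.BirchSwinnertonDyer.BirchSwinnertonDyer.Theorems.AlignedTransportAtTwoCubicClosureParity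
  Summit.BirchSwinnertonDyer.BirchSwinnertonDyer.Theorems.AlignedTransportAtTwoCubicOffStratumRamification
  Summit.BirchSwinnertonDyer.BirchSwinnertonDyer.Theorems.AlignedTransportAtTwoCubicOffStratumDedekindTable
  Summit.BirchSwinnertonDyer.BirchSwinnertonDyer.Theorems.AlignedTransportAtTwoSexticTowerGrowth
  Summit.BirchSwinnertonDyer.BirchSwinnertonDyer.Theorems.AlignedTransportAtTwoCubicOffStratumFukudaIndexTools
  Summit.BirchSwinnertonDyer.BirchSwinnertonDyer.Theorems.AlignedTransportAtTwoCubicOffStratumFukudaIndexTransfer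

variable (W : WeierstrassCurve ℚ) [W.IsElliptic] [W.IsGloballyMinimal]

/-! ## §1 `T = ℚ(W[2])` off the stratum with `Δ_min ≡ 3 (mod 4)`: every prime above `2` has `e = 2` -/

/-- **Every prime of `ℚ(W[2])` above `2` has ramification index `2`** for `W/ℚ` globally minimal, good ordinary at `2`, with no rational
`2`-torsion abscissa and `Δ_min ≡ 3 (mod 4)`. EVEN: `T ∋ 4δ₀` with `(4δ₀)² = Δ_min ≡ 3 (4)` (element certificate). AT MOST `2`: `T/ℚ` is
Galois, so all `e(𝔓|2)` agree (Mathlib `Ideal.ramificationIdx_eq_of_isGaloisGroup`), and above the prime `w₁` of `ℚ(β)` with `e(w₁|2) = 1`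
(cut out by the `2`-adic root of `c_W`, g26) a prime `𝔓₁` has `e(𝔓₁|2) = e(𝔓₁|w₁) ≤ [T : ℚ(β)] = 6/3 = 2`.
[cite: NeukirchANT1999, Ch. I §8 Prop. (8.2), §9 Prop. (9.4); Ch. II §8] [cite: SilvermanAEC2009, VII.2 and VIII.§1] -/
theorem ramificationIdx_divisionField_two_eq_two_of_minimalDiscriminantInt_emod_four_eq_three (hord : IsOrdinaryAt W 2)
    (ht : ∀ x : ℚ, ¬ HasRationalTwoTorsionX W x) (h4 : minimalDiscriminantInt W % 4 = 3)
    [NumberField ↥(W.divisionField 2)]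
    (P : Ideal (𝓞 ↥(W.divisionField 2))) [hP : P.IsPrime] (h2P : (2 : 𝓞 ↥(W.divisionField 2)) ∈ P) :
    P.ramificationIdx ℤ = 2 := by
  have h2 : (2 : ℚ) ≠ 0 := two_ne_zero
  haveI : IsGalois ℚ (W.divisionField 2) := W.isGalois_divisionField 2
  have hΔ : ¬ IsSquare W.Δ := not_isSquare_Δ_of_emod_eight W (by omega)
  -- `δ = 4δ₀ ∈ T`, `δ² = Δ_min`: every `e(𝔓|2)` is even
  obtain ⟨δ, hδdef⟩ : ∃ δ : AlgebraicClosure ℚ, δ = 4 * delta W h2 := ⟨_, rfl⟩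
  have hδsq : δ ^ 2 = ((W.Δ : ℚ) : AlgebraicClosure ℚ) := by rw [hδdef]; exact four_mul_delta_sq W
  have hδT : δ ∈ W.divisionField 2 := by
    rw [hδdef]
    have hd : delta W h2 ∈ W.divisionField 2 := by
      change (xT W h2 0 - xT W h2 1) * (xT W h2 0 - xT W h2 2) * (xT W h2 1 - xT W h2 2) ∈ W.divisionField 2
      exact mul_mem (mul_mem (sub_mem (xT_mem_divisionField W h2 0) (xT_mem_divisionField W h2 1))
        (sub_mem (xT_mem_divisionField W h2 0) (xT_mem_divisionField W h2 2)))
        (sub_mem (xT_mem_divisionField W h2 1) (xT_mem_divisionField W h2 2))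
    exact mul_mem (ofNat_mem _ 4) hd
  have hδT' : (⟨δ, hδT⟩ : W.divisionField 2) ^ 2 = ((minimalDiscriminantInt W : ↥(W.divisionField 2))) := by
    apply Subtype.ext
    rw [SubmonoidClass.coe_pow]
    change δ ^ 2 = _
    rw [hδsq, ← cast_minimalDiscriminantInt W]
    push_cast
    rfl
  have heven : ∀ Q : Ideal (𝓞 ↥(W.divisionField 2)), Q.IsPrime → (2 : 𝓞 ↥(W.divisionField 2)) ∈ Q → Even (Q.ramificationIdx ℤ) :=
    fun Q hQ h2Q => even_ramificationIdx_of_sq_eq_intCast_of_emod_four_eq_three hδT' h4 Q h2Q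
  -- the cubic subfield `F = ℚ(β)`, `[T : F] = 2`
  set β : AlgebraicClosure ℚ := xT W h2 0 with hβdef
  have hβroot : β ∈ W.twoTorsionPolynomial.toPoly.rootSet (AlgebraicClosure ℚ) := xT_mem_rootSet W h2 0
  have hβ : aeval β W.twoTorsionPolynomial.toPoly = 0 :=
    (mem_rootSet_of_ne (twoTorsionPolynomial_toPoly_ne_zero W h2)).mp hβroot
  have hβT : β ∈ W.divisionField 2 := rootSet_subset_divisionField W h2 hβroot
  have hF : ℚ⟮β⟯ ≤ W.divisionField 2 := adjoin_simple_le_iff.mpr hβT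
  letI algF : Algebra ℚ⟮β⟯ (W.divisionField 2) := (IntermediateField.inclusion hF).toRingHom.toAlgebra
  haveI : IsScalarTower ℚ ℚ⟮β⟯ (W.divisionField 2) :=
    IsScalarTower.of_algebraMap_eq fun q ↦ ((IntermediateField.inclusion hF).commutes q).symm
  have hirr := AlignedTransportAtTwoSeed.irr_two_of_forall_not_hasRationalTwoTorsionX W ht
  have hβint : IsIntegral ℚ β := ((AlgebraicClosure.isAlgebraic ℚ).isAlgebraic β).isIntegral
  haveI : FiniteDimensional ℚ ℚ⟮β⟯ := IntermediateField.adjoin.finiteDimensional hβint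
  haveI : NumberField ℚ⟮β⟯ := NumberField.mk
  have hF3 : Module.finrank ℚ ℚ⟮β⟯ = 3 := AddKatoTwo.finrank_adjoin_root_twoTorsionPolynomial_eq_three W hirr hβ
  have hT6 : Module.finrank ℚ (W.divisionField 2) = 6 := finrank_divisionField_two_eq_six W ht hΔ
  haveI : FiniteDimensional ℚ⟮β⟯ (W.divisionField 2) := Module.Finite.of_restrictScalars_finite ℚ _ _
  have hTF : Module.finrank ℚ⟮β⟯ (W.divisionField 2) = 2 := by
    have hmul := Module.finrank_mul_finrank ℚ ℚ⟮β⟯ (W.divisionField 2)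
    rw [hF3, hT6] at hmul
    omega
  -- a prime `w₁` of `ℚ(β)` with `e(w₁|2) = 1`, from the `2`-adic root of `c_W`
  obtain ⟨y, -, hy⟩ := exists_padicInt_root_of_isOrdinaryAt_two W hord
  have he₁ := aeval_four_mul_gen_twoDivisionUCubic W hβ
  have hmin := minpoly_eq_twoDivisionUCubic W ht he₁
  obtain ⟨pb, hgen, -⟩ := exists_powerBasis_gen_eq (natDegree_twoDivisionUCubic W) hF3 hmin
  have hroot : aeval (y : ℚ_[2]) (minpoly ℚ pb.gen) = 0 := by rw [hgen, hmin]; exact hy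
  set σ : ℚ⟮β⟯ →ₐ[ℚ] ℚ_[2] := pb.lift (y : ℚ_[2]) hroot with hσ
  obtain ⟨w₁, hw₁2, hw₁⟩ := exists_heightOneSpectrum_of_ringHom_padic (σ : ℚ⟮β⟯ →+* ℚ_[2])
  have hw₁' : ∀ r : 𝓞 ℚ⟮β⟯, r ∈ w₁.asIdeal ↔ ‖(σ : ℚ⟮β⟯ →+* ℚ_[2]) (algebraMap (𝓞 ℚ⟮β⟯) ℚ⟮β⟯ r)‖ < 1 :=
    mem_iff_norm_lt_one_of_valuation_iff (σ : ℚ⟮β⟯ →+* ℚ_[2]) w₁ hw₁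
  have hew₁ : w₁.asIdeal.ramificationIdx ℤ = 1 := ramificationIdx_eq_one_of_ringHom_padic (σ : ℚ⟮β⟯ →+* ℚ_[2]) w₁ hw₁'
  -- a prime `𝔓₁` of `T` over `w₁`: `e(𝔓₁|2) = e(𝔓₁|w₁) ≤ 2`
  haveI : w₁.asIdeal.IsPrime := w₁.isPrime
  haveI : w₁.asIdeal.IsMaximal := w₁.isMaximal
  obtain ⟨⟨P₁, hP₁prime, hP₁over⟩⟩ := (inferInstance : Nonempty (Ideal.primesOver w₁.asIdeal (𝓞 ↥(W.divisionField 2))))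
  haveI := hP₁prime
  haveI := hP₁over
  haveI : NoZeroSMulDivisors (𝓞 ℚ⟮β⟯) (𝓞 ↥(W.divisionField 2)) := ⟨fun h => smul_eq_zero.mp h⟩
  have hP₁le : P₁.ramificationIdx ℤ ≤ 2 := by
    have h := Ideal.ramificationIdx_le_finrank (𝓞 ↥(W.divisionField 2)) ℚ⟮β⟯ ↥(W.divisionField 2) (p := w₁.asIdeal) P₁
    rw [Ideal.ramificationIdx'_eq_ramificationIdx _ P₁ w₁.ne_bot, hTF] at h
    rw [Ideal.ramificationIdx_tower w₁.asIdeal P₁, hew₁, one_mul]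
    exact h
  have h2P₁ : (2 : 𝓞 ↥(W.divisionField 2)) ∈ P₁ := by
    have := (Ideal.mem_of_liesOver P₁ w₁.asIdeal ((2 : ℕ) : 𝓞 ℚ⟮β⟯)).mp hw₁2
    rw [map_natCast] at this
    exact_mod_cast this
  -- all `e(𝔓|2)` agree (`T/ℚ` Galois)
  haveI : (Ideal.span {(2 : ℤ)}).IsMaximal :=
    Ideal.IsPrime.isMaximal ((Ideal.span_singleton_prime two_ne_zero).mpr Int.prime_two) (by simp)
  haveI hP2 : P.LiesOver (Ideal.span {(2 : ℤ)}) := by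
    rw [Ideal.liesOver_span_iff hP.ne_top Int.prime_two, map_ofNat]; exact h2P
  haveI hP₁2 : P₁.LiesOver (Ideal.span {(2 : ℤ)}) := by
    rw [Ideal.liesOver_span_iff hP₁prime.ne_top Int.prime_two, map_ofNat]; exact h2P₁
  haveI := IsGaloisGroup.of_isFractionRing (↥(W.divisionField 2) ≃ₐ[ℚ] ↥(W.divisionField 2)) ℤ
    (𝓞 ↥(W.divisionField 2)) ℚ ↥(W.divisionField 2)
  have heq : P.ramificationIdx ℤ = P₁.ramificationIdx ℤ :=
    Ideal.ramificationIdx_eq_of_isGaloisGroup (Ideal.span {(2 : ℤ)}) P P₁ (↥(W.divisionField 2) ≃ₐ[ℚ] ↥(W.divisionField 2))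
  have hpos : 0 < P.ramificationIdx ℤ := Ideal.ramificationIdx_pos P ℤ
  obtain ⟨k, hk⟩ := heven P hP h2P
  omega

/-! ## §2 Fukuda's index is `0` for `ℚ(β)` on the sub-cell `Δ_min ≡ 3 (mod 4)` -/

-- The unifications `K ≃ₐ[F] L` ↦ `𝓞 K ≃+* 𝓞 L` / `IsGalois.of_algEquiv` across the nested subfield types `↥(W.divisionField 2)` (over `ℚ⟮β⟯` by
-- inclusion) and `↥T ⊂ \overline{ℚ⟮β⟯}` compare field structures reached along different instance paths; this is slow but finite (route
-- precedent: `…EulerCharAtTwoAssembly`), whence the raised heartbeat limit on this one theorem.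
set_option maxHeartbeats 1000000 in
set_option synthInstance.maxHeartbeats 200000 in
/-- **FUKUDA'S INDEX IS `0` OFF THE STRATUM (`Δ_min ≡ 3 (mod 4)`), KERNEL.** `W/ℚ` globally minimal with good ordinary reduction at `2`, no
rational `2`-torsion abscissa and `Δ_min ≡ 3 (mod 4)`; `β ∈ ℚ̄` a root of the `2`-division cubic; `κ` ANY cyclotomic `ℤ₂`-extension of the cubic
field `ℚ(β)`. Then every prime of `\bar ℤ_{ℚ(β)}` is unramified or TOTALLY ramified in `ℚ(β)_∞/ℚ(β)`: `TotallyRamifiedFrom κ 0`. Equivalently the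
prime `𝔭₂` of `ℚ(β)` with `(e, f) = (2, 1)` (g27's Dedekind table) ramifies again in the first layer `ℚ(β)(√2)` — the completion `ℚ(β)_{𝔭₂} = ℚ₂(√Δ_min)`
is neither `ℚ₂(√2)` nor `ℚ₂(√10)`. Proof: inside `\overline{ℚ(β)}` take `L = κ.layer 1 ∋ √2` and a copy `T` of `ℚ(W[2]) ∋ √Δ_min` (embedded over
`ℚ(β)`; its primes above `2` all have `e = 2`, §1); the ramification transfer of the tools file gives a prime `Q ∋ 2` of `L` with `4 ∣ e(Q|2)`, and the
cubic criterion concludes. [cite: Washington1997, §13.1 Lemma 13.3] [cite: Fukuda1994, p. 264] [cite: NeukirchANT1999, Ch. I §9 Prop. (9.6), Ch. II §8] -/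
theorem totallyRamifiedFrom_zero_adjoin_of_minimalDiscriminantInt_emod_four_eq_three (hord : IsOrdinaryAt W 2)
    (ht : ∀ x : ℚ, ¬ HasRationalTwoTorsionX W x) (h4 : minimalDiscriminantInt W % 4 = 3)
    {β : AlgebraicClosure ℚ} (hβ : aeval β W.twoTorsionPolynomial.toPoly = 0)
    (κP : ZpExtension ℚ⟮β⟯ 2) (hκP : κP.IsCyclotomic) : TotallyRamifiedFrom κP 0 := by
  have h2 : (2 : ℚ) ≠ 0 := two_ne_zero
  haveI : NumberField ↥(W.divisionField 2) := NumberField.mk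
  haveI : IsGalois ℚ (W.divisionField 2) := W.isGalois_divisionField 2
  have hΔ : ¬ IsSquare W.Δ := not_isSquare_Δ_of_emod_eight W (by omega)
  have hirr := AlignedTransportAtTwoSeed.irr_two_of_forall_not_hasRationalTwoTorsionX W ht
  have hβint : IsIntegral ℚ β := ((AlgebraicClosure.isAlgebraic ℚ).isAlgebraic β).isIntegral
  haveI : FiniteDimensional ℚ ℚ⟮β⟯ := IntermediateField.adjoin.finiteDimensional hβint
  haveI : NumberField ℚ⟮β⟯ := NumberField.mk
  have hF3 : Module.finrank ℚ ℚ⟮β⟯ = 3 := AddKatoTwo.finrank_adjoin_root_twoTorsionPolynomial_eq_three W hirr hβ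
  -- `T = ℚ(W[2]) ⊇ ℚ(β)` inside `ℚ̄`, with `δ = 4δ₀`, `δ² = Δ_min`
  have hβroot : β ∈ W.twoTorsionPolynomial.toPoly.rootSet (AlgebraicClosure ℚ) :=
    (mem_rootSet_of_ne (twoTorsionPolynomial_toPoly_ne_zero W h2)).mpr hβ
  have hβT : β ∈ W.divisionField 2 := rootSet_subset_divisionField W h2 hβroot
  have hF : ℚ⟮β⟯ ≤ W.divisionField 2 := adjoin_simple_le_iff.mpr hβT
  letI algF : Algebra ℚ⟮β⟯ (W.divisionField 2) := (IntermediateField.inclusion hF).toRingHom.toAlgebra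
  haveI : IsScalarTower ℚ ℚ⟮β⟯ (W.divisionField 2) :=
    IsScalarTower.of_algebraMap_eq fun q ↦ ((IntermediateField.inclusion hF).commutes q).symm
  haveI : FiniteDimensional ℚ⟮β⟯ (W.divisionField 2) := Module.Finite.of_restrictScalars_finite ℚ _ _
  haveI : IsGalois ℚ⟮β⟯ (W.divisionField 2) := IsGalois.tower_top_of_isGalois ℚ ℚ⟮β⟯ (W.divisionField 2)
  obtain ⟨δ, hδdef⟩ : ∃ δ : AlgebraicClosure ℚ, δ = 4 * delta W h2 := ⟨_, rfl⟩
  have hδsq : δ ^ 2 = ((W.Δ : ℚ) : AlgebraicClosure ℚ) := by rw [hδdef]; exact four_mul_delta_sq W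
  have hδT : δ ∈ W.divisionField 2 := by
    rw [hδdef]
    have hd : delta W h2 ∈ W.divisionField 2 := by
      change (xT W h2 0 - xT W h2 1) * (xT W h2 0 - xT W h2 2) * (xT W h2 1 - xT W h2 2) ∈ W.divisionField 2
      exact mul_mem (mul_mem (sub_mem (xT_mem_divisionField W h2 0) (xT_mem_divisionField W h2 1))
        (sub_mem (xT_mem_divisionField W h2 0) (xT_mem_divisionField W h2 2)))
        (sub_mem (xT_mem_divisionField W h2 1) (xT_mem_divisionField W h2 2))
    exact mul_mem (ofNat_mem _ 4) hd
  have hδT' : (⟨δ, hδT⟩ : W.divisionField 2) ^ 2 = ((minimalDiscriminantInt W : ↥(W.divisionField 2))) := by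
    apply Subtype.ext
    rw [SubmonoidClass.coe_pow]
    change δ ^ 2 = _
    rw [hδsq, ← cast_minimalDiscriminantInt W]
    push_cast
    rfl
  -- embed `T` into `\overline{ℚ(β)}` over `ℚ(β)`: an intermediate field `T ≅ ℚ(W[2])` over `ℚ(β)`
  obtain ⟨T, e, -⟩ : ∃ (T : IntermediateField ℚ⟮β⟯ (AlgebraicClosure ℚ⟮β⟯))
      (_ : ↥(W.divisionField 2) ≃ₐ[ℚ⟮β⟯] ↥T), True := by
    let ι : ↥(W.divisionField 2) →ₐ[ℚ⟮β⟯] AlgebraicClosure ℚ⟮β⟯ := IsAlgClosed.lift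
    exact ⟨(⊤ : IntermediateField ℚ⟮β⟯ ↥(W.divisionField 2)).map ι,
      (IntermediateField.topEquiv.symm.trans (IntermediateField.equivMap ⊤ ι)), trivial⟩
  haveI : FiniteDimensional ℚ⟮β⟯ T := LinearEquiv.finiteDimensional e.toLinearEquiv
  haveI : IsGalois ℚ⟮β⟯ T := IsGalois.of_algEquiv e
  haveI : NumberField T := NumberField.of_module_finite ℚ⟮β⟯ T
  have hδ''T : ((e ⟨δ, hδT⟩ : T) : AlgebraicClosure ℚ⟮β⟯) ∈ T := (e ⟨δ, hδT⟩).2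
  have hδ''sq : ((e ⟨δ, hδT⟩ : T) : AlgebraicClosure ℚ⟮β⟯) ^ 2 = ((minimalDiscriminantInt W : AlgebraicClosure ℚ⟮β⟯)) := by
    have h1 : (e ⟨δ, hδT⟩ : T) ^ 2 = ((minimalDiscriminantInt W : T)) := by rw [← map_pow, hδT', map_intCast]
    have h2 := congrArg (fun z : T => (z : AlgebraicClosure ℚ⟮β⟯)) h1
    simpa using h2
  -- the primes of `T` above `2` have `e ≤ 2` (transport of §1 along `e`)
  have hT0 : ∀ P : Ideal (𝓞 ↥(W.divisionField 2)), P.IsPrime → (2 : 𝓞 ↥(W.divisionField 2)) ∈ P →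
      P.ramificationIdx ℤ ≤ 2 := by
    intro P hP h2P
    exact (ramificationIdx_divisionField_two_eq_two_of_minimalDiscriminantInt_emod_four_eq_three W hord ht h4 P h2P).le
  have hT : ∀ P : Ideal (𝓞 T), P.IsPrime → (2 : 𝓞 T) ∈ P → P.ramificationIdx ℤ ≤ 2 :=
    forall_ramificationIdx_le_of_ringEquiv (RingOfIntegers.mapRingEquiv e.symm.toRingEquiv) hT0
  -- the first layer `L = κ.layer 1 ∋ √2`
  have hK2 : ¬ 2 ∣ Module.finrank ℚ ℚ⟮β⟯ := by rw [hF3]; norm_num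
  haveI : FiniteDimensional ℚ⟮β⟯ (κP.layer 1) := κP.finiteDimensional_layer_holds 1
  haveI : IsGalois ℚ⟮β⟯ (κP.layer 1) := κP.isGalois_layer_holds 1
  obtain ⟨θ, hθ⟩ := exists_sq_eq_two_layer_one_of_not_dvd_finrank hK2 κP hκP
  have hθ' : ((θ : AlgebraicClosure ℚ⟮β⟯)) ^ 2 = 2 := by
    have := congrArg (fun z : κP.layer 1 => (z : AlgebraicClosure ℚ⟮β⟯)) hθ
    simp only [SubmonoidClass.coe_pow] at this
    rw [this]; rfl
  -- the prime `𝔭₂` of `ℚ(β)` with `e = 2`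
  obtain ⟨w, hw2, hwe, -⟩ := exists_ramificationIdx_eq_two_adjoin_of_minimalDiscriminantInt_emod_four_eq_three W hord ht h4 hβ
  haveI : w.asIdeal.IsPrime := w.isPrime
  have hw2' : (2 : 𝓞 ℚ⟮β⟯) ∈ w.asIdeal := by exact_mod_cast hw2
  -- transfer and conclude
  obtain ⟨Q, hQ, h2Q, h4Q⟩ := exists_four_dvd_ramificationIdx_of_sq_eq_two_of_sq_eq_intCast (κP.layer 1) T θ.2 hδ''T hθ'
    hδ''sq h4 w.asIdeal hw2' hwe hT
  exact totallyRamifiedFrom_zero_of_exists_four_dvd_ramificationIdx hF3 κP hκP ⟨Q, hQ, h2Q, h4Q⟩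

/-! ## §3 UNIFORM: Fukuda's index is `0` for `ℚ(β)` of every good-ordinary seed-cell curve; the layer-pair doors without ramification bit -/

/-- **FUKUDA'S INDEX IS `0` FOR `ℚ(β)`, EVERY GOOD-ORDINARY SEED-CELL CURVE.** `W/ℚ` globally minimal with good ordinary reduction at `2` and no rational
`2`-torsion abscissa, `β ∈ ℚ̄` a root of the `2`-division cubic: every cyclotomic `ℤ₂`-extension `κ` of `ℚ(β)` has `TotallyRamifiedFrom κ 0` (every prime
of `ℚ(β)` above `2` is totally ramified in `ℚ(β)_∞/ℚ(β)` from the bottom). `Δ_min` is odd (good reduction); `Δ_min ≡ 1 (mod 4)`: all indices above `2`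
are odd (att-p5 g27) and bsd-2adic's parity criterion applies; `Δ_min ≡ 3 (mod 4)`: §2. [cite: Fukuda1994, p. 264 (the index `n₀`)]
[cite: Washington1997, §13.1 Lemma 13.3] [cite: NeukirchANT1999, Ch. I §8–§9] -/
theorem totallyRamifiedFrom_zero_adjoin_of_isOrdinaryAt_two (hord : IsOrdinaryAt W 2) (ht : ∀ x : ℚ, ¬ HasRationalTwoTorsionX W x)
    {β : AlgebraicClosure ℚ} (hβ : aeval β W.twoTorsionPolynomial.toPoly = 0)
    (κP : ZpExtension ℚ⟮β⟯ 2) (hκP : κP.IsCyclotomic) : TotallyRamifiedFrom κP 0 := by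
  by_cases h4 : minimalDiscriminantInt W % 4 = 3
  · exact totallyRamifiedFrom_zero_adjoin_of_minimalDiscriminantInt_emod_four_eq_three W hord ht h4 hβ κP hκP
  · have h2 : ¬ (2 : ℤ) ∣ minimalDiscriminantInt W := by
      exact_mod_cast W.not_dvd_minimalDiscriminantInt_of_hasGoodReductionAtPrime 2 hord.1
    have h1 : minimalDiscriminantInt W % 4 = 1 := by omega
    have hodd := (forall_odd_ramificationIdx_adjoin_iff_minimalDiscriminantInt_emod_four_eq_one W hord ht hβ).mpr h1
    have hirr := AlignedTransportAtTwoSeed.irr_two_of_forall_not_hasRationalTwoTorsionX W ht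
    have hβint : IsIntegral ℚ β := ((AlgebraicClosure.isAlgebraic ℚ).isAlgebraic β).isIntegral
    haveI : FiniteDimensional ℚ ℚ⟮β⟯ := IntermediateField.adjoin.finiteDimensional hβint
    haveI : NumberField ℚ⟮β⟯ := NumberField.mk
    have hF3 : Module.finrank ℚ ℚ⟮β⟯ = 3 := AddKatoTwo.finrank_adjoin_root_twoTorsionPolynomial_eq_three W hirr hβ
    have hK2 : ¬ 2 ∣ Module.finrank ℚ ℚ⟮β⟯ := by rw [hF3]; norm_num
    exact totallyRamifiedFrom_zero_of_forall_odd_ramificationIdx hK2 κP hκP hodd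

/-- **THE CLASS-NUMBER DOOR AT ANY LAYER PAIR, NO RAMIFICATION BIT.** `W` globally minimal, good ordinary at `2`, no rational `2`-torsion abscissa,
`β` a root of the `2`-division cubic, `κ` a cyclotomic `ℤ₂`-extension of `ℚ(β)`: ONE pair of consecutive layers `(n, n+1)`, ANY `n ≥ 0`, with the same
`2`-class-number exponent `e_{n+1} = e_n` gives Iwasawa's `μ₂ = 0` (indeed `e_m = e_n` for `m ≥ n`; Fukuda 1994 Thm. 1 (1) from index `0`).
[cite: Fukuda1994, Thm. 1 (1), p. 264] [cite: Washington1997, §13.1] -/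
theorem classicalMuVanishes_adjoin_of_classNumberPExp_succ_eq (hord : IsOrdinaryAt W 2) (ht : ∀ x : ℚ, ¬ HasRationalTwoTorsionX W x)
    {β : AlgebraicClosure ℚ} (hβ : aeval β W.twoTorsionPolynomial.toPoly = 0)
    (κP : ZpExtension ℚ⟮β⟯ 2) (hκP : κP.IsCyclotomic) {n : ℕ} (he : classNumberPExp κP (n + 1) = classNumberPExp κP n) :
    ClassicalMuVanishes κP := by
  have hβint : IsIntegral ℚ β := ((AlgebraicClosure.isAlgebraic ℚ).isAlgebraic β).isIntegral
  haveI : FiniteDimensional ℚ ℚ⟮β⟯ := IntermediateField.adjoin.finiteDimensional hβint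
  haveI : NumberField ℚ⟮β⟯ := NumberField.mk
  exact classicalMuVanishes_of_classNumberPExp_succ_eq' κP (totallyRamifiedFrom_zero_adjoin_of_isOrdinaryAt_two W hord ht hβ κP hκP)
    (Nat.zero_le n) he

/-- **THE RANK DOOR AT ANY LAYER PAIR, NO RAMIFICATION BIT.** Same hypotheses; ONE pair of consecutive layers `(n, n+1)`, ANY `n ≥ 0`, with
`rank₂ Cl(ℚ(β)_{n+1}) = rank₂ Cl(ℚ(β)_n)` gives `μ₂ = 0` (Fukuda 1994 Thm. 1 (2) from index `0`) — att-p4 g24's `…CubicRankDoorLayerOne` (`1 ≤ n`, index `1`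
automatic for cubic fields) extended to the pair `(0, 1)`. [cite: Fukuda1994, Thm. 1 (2), p. 264] [cite: Washington1997, §13.1] -/
theorem classicalMuVanishes_adjoin_of_classGroupPRank_succ_eq (hord : IsOrdinaryAt W 2) (ht : ∀ x : ℚ, ¬ HasRationalTwoTorsionX W x)
    {β : AlgebraicClosure ℚ} (hβ : aeval β W.twoTorsionPolynomial.toPoly = 0)
    (κP : ZpExtension ℚ⟮β⟯ 2) (hκP : κP.IsCyclotomic) {n : ℕ} (hr : classGroupPRank κP (n + 1) = classGroupPRank κP n) :
    ClassicalMuVanishes κP := by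
  have hβint : IsIntegral ℚ β := ((AlgebraicClosure.isAlgebraic ℚ).isAlgebraic β).isIntegral
  haveI : FiniteDimensional ℚ ℚ⟮β⟯ := IntermediateField.adjoin.finiteDimensional hβint
  haveI : NumberField ℚ⟮β⟯ := NumberField.mk
  exact classicalMuVanishes_of_classGroupPRank_succ_eq' κP (totallyRamifiedFrom_zero_adjoin_of_isOrdinaryAt_two W hord ht hβ κP hκP)
    (Nat.zero_le n) hr

end Summit.BirchSwinnertonDyer.BirchSwinnertonDyer.Theorems.AlignedTransportAtTwoCubicOffStratumFukudaIndex

end
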